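import Mathlib.RingTheory.Nullstellensatz
import Mathlib.Algebra.MvPolynomial.Monad
import HarnessLib

/-!
# Closing lemma toolkit (1): products of irreducible affine point sets are irreducible

Route `FrobeniusClosing`, support item `ClosingLemma` (stmt-ResolutionOfSingularities-16348).
Point-set algebraic geometry over a field `F` in coordinates, phrased with Mathlib's
`MvPolynomial.vanishingIdeal F V` (for `V ⊆ F^σ`): a point set is *irreducible* when its vanishing
ideal is prime, and a subset `D ⊆ V` is *dense* when the vanishing ideals agree.

For a family of point sets `X i ⊆ F^σ` (`i : Fin r`) the **product set** is
`{u : Fin r × σ → F | ∀ i, (fun s => u (i, s)) ∈ X i}`.  We prove, by moving one block at a time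
along slices (no tensor products, no scheme theory):

* `isPrime_vanishingIdeal_pi` — a finite product of irreducible point sets is irreducible;
* `vanishingIdeal_pi_eq_of_forall_eq` — blockwise dense families have dense products;
* `vanishingIdeal_reindex` — vanishing ideals under a reindexing of the coordinates.

These feed the closing step of the proof of `ClosingLemma` (the cyclic product of the edge
correspondences of a walk of loci is again an irreducible bi-dominant correspondence, to which the
twisted Lang–Weil estimate applies). OURS; elementary. [folklore]
-/

noncomputable section

-- single-problem summit: the doubled namespace component `ResolutionOfSingularities` is forced
set_option linter.dupNamespace false

open MvPolynomial

namespace Summit.ResolutionOfSingularities.ResolutionOfSingularities.Theorems.FrobeniusClosing.ClosingArena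

variable {F : Type*} [Field F] {σ : Type*} {r : ℕ}

/-! ## Slices through a point along one block -/

/-- Evaluating the slice of `f` through `u` along block `t` at `x` is evaluating `f` at `u` with
block `t` replaced by `x`. [folklore] -/
theorem aeval_slice (u : Fin r × σ → F) (t : Fin r) (f : MvPolynomial (Fin r × σ) F) (x : σ → F) :
    aeval x (bind₁ (fun q : Fin r × σ => if q.1 = t then X q.2 else C (u q)) f) =
      aeval (fun q : Fin r × σ => if q.1 = t then x q.2 else u q) f := by
  have h : (fun q : Fin r × σ =>
      aeval x (if q.1 = t then (X q.2 : MvPolynomial σ F) else C (u q))) =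
      fun q : Fin r × σ => if q.1 = t then x q.2 else u q := by
    funext q
    split_ifs <;> simp
  rw [aeval_bind₁, h]

omit [Field F] in
/-- Replacing block `t` of `u` by its own block `t` gives back `u`. [folklore] -/
theorem update_self (u : Fin r × σ → F) (t : Fin r) :
    (fun q : Fin r × σ => if q.1 = t then u (t, q.2) else u q) = u := by
  funext q
  split_ifs with h
  · rw [← h]
  · rfl

/-- A point set with prime vanishing ideal is non-empty. [folklore] -/
theorem nonempty_of_isPrime_vanishingIdeal {τ : Type*} {V : Set (τ → F)}
    (hV : (vanishingIdeal F V).IsPrime) : V.Nonempty := by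
  by_contra h
  rw [Set.not_nonempty_iff_eq_empty] at h
  exact hV.ne_top (by rw [h, vanishingIdeal_empty])

/-- A polynomial outside the vanishing ideal has a non-vanishing point. [folklore] -/
theorem exists_aeval_ne_zero_of_not_mem {τ : Type*} {V : Set (τ → F)} {f : MvPolynomial τ F}
    (hf : f ∉ vanishingIdeal F V) : ∃ x ∈ V, aeval x f ≠ 0 := by
  by_contra h
  push Not at h
  exact hf ((mem_vanishingIdeal_iff).2 h)

/-! ## Products of irreducible point sets -/

/-- **A finite product of irreducible affine point sets is irreducible**: if every `X i ⊆ F^σ` has a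
prime vanishing ideal, so does `{u | ∀ i, u(i, ·) ∈ X i} ⊆ F^(Fin r × σ)`.  Proof: given `f, g`
outside the ideal with witnesses `u, u''`, make the witnesses agree block by block using the
irreducibility of each slice. [folklore] -/
theorem isPrime_vanishingIdeal_pi (X : Fin r → Set (σ → F))
    (hX : ∀ i, (vanishingIdeal F (X i)).IsPrime) :
    (vanishingIdeal F {u : Fin r × σ → F | ∀ i, (fun s => u (i, s)) ∈ X i}).IsPrime := by
  classical
  set PiSet : Set (Fin r × σ → F) := {u | ∀ i, (fun s => u (i, s)) ∈ X i} with hPiSet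
  -- the key moving claim
  have key : ∀ (f g : MvPolynomial (Fin r × σ) F), f * g ∈ vanishingIdeal F PiSet →
      ∀ t : ℕ, t ≤ r → ∀ u u'' : Fin r × σ → F, u ∈ PiSet → u'' ∈ PiSet →
        aeval u f ≠ 0 → aeval u'' g ≠ 0 → (∀ q : Fin r × σ, t ≤ (q.1 : ℕ) → u q = u'' q) → False := by
    intro f g hfg t
    induction t with
    | zero =>
      intro _ u u'' hu _ hf hg hagree
      have heq : u = u'' := funext fun q => hagree q (Nat.zero_le _)
      subst heq
      have h0 : aeval u (f * g) = 0 := (mem_vanishingIdeal_iff.1 hfg) u hu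
      rw [map_mul] at h0
      exact mul_ne_zero hf hg h0
    | succ t ih =>
      intro htr u u'' hu hu'' hf hg hagree
      have ht : t < r := htr
      set T : Fin r := ⟨t, ht⟩ with hT
      -- slices along block `T`
      set φ := bind₁ (fun q : Fin r × σ => if q.1 = T then MvPolynomial.X q.2 else C (u q)) f with hφ
      set ψ := bind₁ (fun q : Fin r × σ => if q.1 = T then MvPolynomial.X q.2 else C (u'' q)) g with hψ
      have hφX : φ ∉ vanishingIdeal F (X T) := by
        intro hmem
        have h1 := (mem_vanishingIdeal_iff.1 hmem) (fun s => u (T, s)) (hu T)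
        rw [hφ, aeval_slice, update_self] at h1
        exact hf h1
      have hψX : ψ ∉ vanishingIdeal F (X T) := by
        intro hmem
        have h1 := (mem_vanishingIdeal_iff.1 hmem) (fun s => u'' (T, s)) (hu'' T)
        rw [hψ, aeval_slice, update_self] at h1
        exact hg h1
      have hprod : φ * ψ ∉ vanishingIdeal F (X T) := fun hmem =>
        ((hX T).mem_or_mem hmem).elim hφX hψX
      obtain ⟨x, hxX, hx⟩ := exists_aeval_ne_zero_of_not_mem hprod
      rw [map_mul] at hx
      have hφx : aeval x φ ≠ 0 := left_ne_zero_of_mul hx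
      have hψx : aeval x ψ ≠ 0 := right_ne_zero_of_mul hx
      rw [hφ, aeval_slice] at hφx
      rw [hψ, aeval_slice] at hψx
      -- the moved witnesses
      have hmem : ∀ v : Fin r × σ → F, v ∈ PiSet →
          (fun q : Fin r × σ => if q.1 = T then x q.2 else v q) ∈ PiSet := by
        intro v hv i
        by_cases hi : i = T
        · subst hi
          have : (fun s => (fun q : Fin r × σ => if q.1 = T then x q.2 else v q) (T, s)) = x := by
            funext s; simp
          rw [this]; exact hxX
        · have : (fun s => (fun q : Fin r × σ => if q.1 = T then x q.2 else v q) (i, s)) =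
              fun s => v (i, s) := by
            funext s; simp [hi]
          rw [this]; exact hv i
      refine ih (Nat.le_of_lt ht) _ _ (hmem u hu) (hmem u'' hu'') hφx hψx ?_
      intro q hq
      by_cases hq1 : q.1 = T
      · simp [hq1]
      · simp only [hq1, if_false]
        apply hagree q
        have hne : (q.1 : ℕ) ≠ t := fun h => hq1 (Fin.ext (by rw [h]))
        omega
  refine ⟨?_, ?_⟩
  · -- proper
    intro htop
    have hne : ∀ i, (X i).Nonempty := fun i => nonempty_of_isPrime_vanishingIdeal (hX i)
    choose x hx using hne
    have hu : (fun q : Fin r × σ => x q.1 q.2) ∈ PiSet := fun i => hx i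
    have h1 : (1 : MvPolynomial (Fin r × σ) F) ∈ vanishingIdeal F PiSet := by rw [htop]; trivial
    have := (mem_vanishingIdeal_iff.1 h1) _ hu
    rw [map_one] at this
    exact one_ne_zero this
  · intro f g hfg
    by_contra h
    push Not at h
    obtain ⟨u, hu, hf⟩ := exists_aeval_ne_zero_of_not_mem h.1
    obtain ⟨u'', hu'', hg⟩ := exists_aeval_ne_zero_of_not_mem h.2
    exact key f g hfg r le_rfl u u'' hu hu'' hf hg (fun q hq => absurd q.1.2 (not_lt.2 hq))

/-- **Blockwise dense families have dense products**: if `vanishingIdeal (D i) = vanishingIdeal (X i)`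
for every block, the product sets have the same vanishing ideal. [folklore] -/
theorem vanishingIdeal_pi_le_of_forall_eq (D X : Fin r → Set (σ → F))
    (h : ∀ i, vanishingIdeal F (D i) = vanishingIdeal F (X i)) :
    vanishingIdeal F {u : Fin r × σ → F | ∀ i, (fun s => u (i, s)) ∈ D i} ≤
      vanishingIdeal F {u : Fin r × σ → F | ∀ i, (fun s => u (i, s)) ∈ X i} := by
  classical
  intro f hf
  -- claim: `f` vanishes at every point whose blocks `< t` lie in `X` and blocks `≥ t` in `D`
  have key : ∀ t : ℕ, t ≤ r → ∀ u : Fin r × σ → F,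
      (∀ i : Fin r, (i : ℕ) < t → (fun s => u (i, s)) ∈ X i) →
      (∀ i : Fin r, t ≤ (i : ℕ) → (fun s => u (i, s)) ∈ D i) → aeval u f = 0 := by
    intro t
    induction t with
    | zero =>
      intro _ u _ hD
      exact (mem_vanishingIdeal_iff.1 hf) u fun i => hD i (Nat.zero_le _)
    | succ t ih =>
      intro htr u hXu hDu
      have ht : t < r := htr
      set T : Fin r := ⟨t, ht⟩ with hT
      set φ := bind₁ (fun q : Fin r × σ => if q.1 = T then MvPolynomial.X q.2 else C (u q)) f with hφ
      have hφD : φ ∈ vanishingIdeal F (D T) := by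
        rw [mem_vanishingIdeal_iff]
        intro x hx
        rw [hφ, aeval_slice]
        apply ih (Nat.le_of_lt ht)
        · intro i hi
          have hi' : i ≠ T := fun h => by subst h; exact lt_irrefl _ hi
          have : (fun s => (fun q : Fin r × σ => if q.1 = T then x q.2 else u q) (i, s)) =
              fun s => u (i, s) := by funext s; simp [hi']
          rw [this]
          exact hXu i (Nat.lt_succ_of_lt hi)
        · intro i hi
          by_cases hi' : i = T
          · subst hi'
            have : (fun s => (fun q : Fin r × σ => if q.1 = T then x q.2 else u q) (T, s)) = x := by
              funext s; simp
            rw [this]; exact hx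
          · have : (fun s => (fun q : Fin r × σ => if q.1 = T then x q.2 else u q) (i, s)) =
                fun s => u (i, s) := by funext s; simp [hi']
            rw [this]
            apply hDu i
            have hne : (i : ℕ) ≠ t := fun h => hi' (Fin.ext (by rw [h]))
            omega
      rw [h T] at hφD
      have h1 := (mem_vanishingIdeal_iff.1 hφD) (fun s => u (T, s)) (hXu T (Nat.lt_succ_self _))
      rwa [hφ, aeval_slice, update_self] at h1
  rw [mem_vanishingIdeal_iff]
  intro u hu
  exact key r le_rfl u (fun i _ => hu i) (fun i hi => absurd i.2 (not_lt.2 hi))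

/-- Blockwise dense families have products with equal vanishing ideals. [folklore] -/
theorem vanishingIdeal_pi_eq_of_forall_eq (D X : Fin r → Set (σ → F))
    (h : ∀ i, vanishingIdeal F (D i) = vanishingIdeal F (X i)) :
    vanishingIdeal F {u : Fin r × σ → F | ∀ i, (fun s => u (i, s)) ∈ D i} =
      vanishingIdeal F {u : Fin r × σ → F | ∀ i, (fun s => u (i, s)) ∈ X i} :=
  le_antisymm (vanishingIdeal_pi_le_of_forall_eq D X h)
    (vanishingIdeal_pi_le_of_forall_eq X D fun i => (h i).symm)

/-! ## Reindexing the coordinates -/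

/-- Vanishing ideal of a reindexed point set: for `e : α ≃ β`,
`I({w | w ∘ e ∈ V}) = I(V).comap (rename e.symm)`. [folklore] -/
theorem vanishingIdeal_reindex {α β : Type*} (e : α ≃ β) (V : Set (α → F)) :
    vanishingIdeal F {w : β → F | w ∘ e ∈ V} =
      (vanishingIdeal F V).comap (rename e.symm : MvPolynomial β F →ₐ[F] MvPolynomial α F) := by
  ext f
  rw [Ideal.mem_comap, mem_vanishingIdeal_iff, mem_vanishingIdeal_iff]
  constructor
  · intro h v hv
    rw [aeval_rename]
    apply h
    show (v ∘ e.symm) ∘ e ∈ V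
    have : (v ∘ ⇑e.symm) ∘ ⇑e = v := by funext a; simp
    rw [this]; exact hv
  · intro h w hw
    have h1 := h (w ∘ e) hw
    rw [aeval_rename] at h1
    have : (w ∘ ⇑e) ∘ ⇑e.symm = w := by funext b; simp
    rwa [this] at h1

/-- Reindexing preserves irreducibility. [folklore] -/
theorem isPrime_vanishingIdeal_reindex {α β : Type*} (e : α ≃ β) (V : Set (α → F))
    (hV : (vanishingIdeal F V).IsPrime) : (vanishingIdeal F {w : β → F | w ∘ e ∈ V}).IsPrime := by
  rw [vanishingIdeal_reindex]
  exact Ideal.IsPrime.comap _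

end Summit.ResolutionOfSingularities.ResolutionOfSingularities.Theorems.FrobeniusClosing.ClosingArena

end
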